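import Summits.QuantumFields.QCD.Theses.SpectralDefectExtinction
import Summits.QuantumFields.QCD.Theorems.SpectralDefectExtinctionTipPricingIntensiveTightOfMoments
import Summits.QuantumFields.QCD.Theorems.SpectralDefectExtinctionTipPricingTightOfIndexMoments

/-!
# `TipPricing` (stmt-QuantumFields-8967) — line `line-tight-from-two-moments`, RESHAPE a2-r1 against route rev 11
(line lead a2, 2026-08-17; supersedes the planners' skeleton `Cruxes/TipPricing/Lines/tight-from-two-moments.lean`,
whose composition enters through the stale `WithoutTightCollapse.windowExtinction_iff` — an `Iff.rfl` against the
RETIRED body of `WindowExtinction` that no longer elaborates from source)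

Crux: `TipPricing := TipNoBinding → WegnerEstimate → WindowExtinction` with `WindowExtinction` the rev-9 body
(stmt-QuantumFields-18063: mass scaling, asymptotic scaling, CAP `∃ p, ∀ᶠ k, L_k ≤ a_k^{-p}`, BRANCH `∀ᶠ k, −1 < m_crit(k)`,
EXTINCT (a)+(b), TIGHT⁺ `∃ η > 0, ∀ M > M₀, ∀ᶠ k, max 1 (η (a_k(2L_k+1))²) ≤ E₊|Q_k(M)|`).

Skeleton: ONE open stub + landed glue.
* `stub_floorCapWitness` (OPEN; crux-sized = the physical content of stmt-18063 in two-moment form):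
  `WegnerEstimate →` for `N_f ∈ {2,3}` a regularisation with mass/asymptotic scaling, CAP, BRANCH, `M₀ ≥ 0`, `c > 0`,
  and for every `m > M₀`: EXTINCT verbatim ∧ `∃ χ₀ > 0, ∃ K₄ > 0, ∀ M > M₀, ∀ᶠ k, Z_k > 0 ∧ χ₀ (a_k(2L_k+1))⁴ Z_k ≤ S₂ ∧ S₄ Z_k ≤ K₄ S₂²`
  (intensive susceptibility floor `E₊Q² ≥ χ₀ V_phys` = `χ_t > 0` along the trajectory under the |det| weights, and a
  kurtosis cap — Leutwyler–Smilga scale; no tool in the tree or in print: grounder g72-3 on 18063).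
* glue (PROVED, p136549 `Theorems/SpectralDefectExtinctionTipPricingTightPlusOfMoments.lean`, registered stubs
  `stub_tightPlusOfMoments`, `stub_windowExtinctionOfFloorCap`, `stub_tipPricingOfFloorCap`; inlined below under the
  sub-namespace `SkeletonA2` so that this file is self-contained until that module is built on the farm):
  floor + cap ⇒ TIGHT⁺ (Hölder (3/2,3), `intensiveTight_of_indexMoments`, `a_k L_k → ∞` absorbs `max 1`), and the
  packing into the rev-9 `∃ reg` body.
* `TipPricing_of : TipPricing` — concludes the crux BY NAME; sorries only in `stub_floorCapWitness`.

Why the line is nevertheless DEAD (lead a2 verdict, `Lines/line-tight-from-two-moments.dead.md`): its only open stub is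
the hinge 18063 itself up to the (slightly stronger) moment form of TIGHT⁺; nothing in the line's `Leans on`
(WegnerEstimate = an UPPER DOS bound; TipNoBinding = proved, idle) moves it.
-/

noncomputable section

namespace Summit.QuantumFields.QCD.Cruxes.TipPricing.TightFromTwoMoments

open scoped BigOperators Topology Classical
open MeasureTheory Filter
open Literature.MathematicalPhysics.QuantumLattice Literature.MathematicalPhysics.QuantumFieldTheory
  Literature.Probability.LatticeModels
open Summit.QuantumFields.QCD.Theses.SpectralDefectExtinction

/-! ## The open stub -/

/-- STUB (OPEN, crux-sized): **the FLOOR–CAP witness from the Wegner estimate.** For `N_f ∈ {2,3}`: a mass-scaling,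
asymptotically scaling Wilson regularisation with polynomial volume cap and branch clause, a threshold `M₀ ≥ 0` and
`c > 0` such that every mass tuple `m > M₀` has EXTINCT (verbatim from `WindowExtinction`) and, for some `χ₀, K₄ > 0` and
every probe `M > M₀`, eventually in `k`: `Z_k > 0`, the intensive susceptibility floor `χ₀ (a_k(2L_k+1))⁴ Z_k ≤ S₂(k,M)`
and the kurtosis cap `S₄(k,M) Z_k ≤ K₄ S₂(k,M)²` (`Z_k = ∫ ∏_f|det D_W(U,m_f(k),1)|`, `S_j = ∫ Q_k(M)^j ∏_f|det …|`,
`Q_k(M) = n₋(Γ₅D_W(U, m_crit(k) − a_kM/Z_m(k), 1)) − 6(2L_k+1)⁴`, Wilson measure of the scheme torus at `β_k`).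
Physical content: `χ_t > 0` (Leutwyler–Smilga `E Q² ≍ χ_t V_phys`) with bounded kurtosis under the phase-quenched
measure along an asymptotically free trajectory, jointly with spectral-defect extinction — stmt-18063. -/
theorem stub_floorCapWitness : WegnerEstimate → ∀ Nf : ℕ, (Nf = 2 ∨ Nf = 3) → ∃ reg : QCDRegularisation Nf, reg.HasMassScaling ∧ (reg.scheme 0 0 0).HasAsymptoticScaling ∧ (∃ p : ℕ, ∀ᶠ k : ℕ in Filter.atTop, (reg.L k : ℝ) ≤ (reg.a k)⁻¹ ^ p) ∧ (∀ᶠ k : ℕ in Filter.atTop, -1 < reg.mcrit k) ∧ ∃ M₀ : ℝ, 0 ≤ M₀ ∧ ∃ c : ℝ, 0 < c ∧ ∀ m : Fin Nf → ℝ, (∀ f, M₀ < m f) → (∀ ε : ℝ, 0 < ε → ∀ᶠ k : ℕ in Filter.atTop, ∀ S : ℕ, reg.L k ≤ S → (∫ U, ((∑ f : Fin Nf, ((Multiset.countP (fun z : ℂ => z.im = 0 ∧ z.re < -(reg.mcrit k + reg.a k * m f / reg.Zm k)) (wilsonDirac (fundamentalRep (Fin 3)) U 0 1).charpoly.roots :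 ℝ) + (Multiset.countP (fun z : ℂ => |z.re| < c * (reg.a k * m f / reg.Zm k)) (spinorLift gammaFive * wilsonDirac (fundamentalRep (Fin 3)) U (reg.mcrit k + reg.a k * m f / reg.Zm k) 1).charpoly.roots : ℝ)))) * ∏ f : Fin Nf, ‖fermionDet (wilsonDirac (fundamentalRep (Fin 3)) U (reg.mcrit k + reg.a k * m f / reg.Zm k) 1)‖ ∂(wilsonMeasure (d := 4) (L := 2 * S + 1) (fundamentalRep (Fin 3)) (reg.β k))) / (∫ U, ∏ f : Fin Nf, ‖fermionDet (wilsonDirac (fundamentalRep (Fin 3)) U (reg.mcrit k + reg.a k * m f / reg.Zm k) 1)‖ ∂(wilsonMeasure (d := 4) (L := 2 * S + 1) (fundamentalRep (Fin 3)) (reg.β k))) ≤ ε * ((2 * S + 1 : ℝ) / (2 * reg.L k + 1)) ^ 4) ∧ ∃ χ₀ : ℝ, 0 < χ₀ ∧ ∃ K₄ : ℝ, 0 < K₄ ∧ ∀ M : ℝ, M₀ < M → ∀ᶠ k : ℕ in Filter.atTop, 0 < (∫ U, ∏ f : Fin Nf, ‖fermionDet (wilsonDirac (fundamentalRep (Fin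 3)) U (reg.mcrit k + reg.a k * m f / reg.Zm k) 1)‖ ∂(wilsonMeasure (d := 4) (L := 2 * reg.L k + 1) (fundamentalRep (Fin 3)) (reg.β k))) ∧ χ₀ * (reg.a k * (2 * reg.L k + 1 : ℝ)) ^ 4 * (∫ U, ∏ f : Fin Nf, ‖fermionDet (wilsonDirac (fundamentalRep (Fin 3)) U (reg.mcrit k + reg.a k * m f / reg.Zm k) 1)‖ ∂(wilsonMeasure (d := 4) (L := 2 * reg.L k + 1) (fundamentalRep (Fin 3)) (reg.β k))) ≤ (∫ U, ((Multiset.countP (fun z : ℂ => z.re < 0) (spinorLift gammaFive * wilsonDirac (fundamentalRep (Fin 3)) U (reg.mcrit k - reg.a k * M / reg.Zm k) 1).charpoly.roots : ℝ) - 6 * (2 * reg.L k + 1 : ℝ) ^ 4) ^ 2 * ∏ f : Fin Nf, ‖fermionDet (wilsonDirac (fundamentalRep (Fin 3)) U (reg.mcrit k + reg.a k * m f / reg.Zm k) 1)‖ ∂(wilsonMeasure (d := 4) (L := 2 * reg.L k + 1) (fundamentalRep (Fin 3)) (reg.β k))) ∧ (∫ U, ((Multiset.countP (fun z : ℂ =>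 z.re < 0) (spinorLift gammaFive * wilsonDirac (fundamentalRep (Fin 3)) U (reg.mcrit k - reg.a k * M / reg.Zm k) 1).charpoly.roots : ℝ) - 6 * (2 * reg.L k + 1 : ℝ) ^ 4) ^ 4 * ∏ f : Fin Nf, ‖fermionDet (wilsonDirac (fundamentalRep (Fin 3)) U (reg.mcrit k + reg.a k * m f / reg.Zm k) 1)‖ ∂(wilsonMeasure (d := 4) (L := 2 * reg.L k + 1) (fundamentalRep (Fin 3)) (reg.β k))) * (∫ U, ∏ f : Fin Nf, ‖fermionDet (wilsonDirac (fundamentalRep (Fin 3)) U (reg.mcrit k + reg.a k * m f / reg.Zm k) 1)‖ ∂(wilsonMeasure (d := 4) (L := 2 * reg.L k + 1) (fundamentalRep (Fin 3)) (reg.β k))) ≤ K₄ * (∫ U, ((Multiset.countP (fun z : ℂ => z.re < 0) (spinorLift gammaFive * wilsonDirac (fundamentalRep (Fin 3)) U (reg.mcrit k - reg.a k * M / reg.Zm k) 1).charpoly.roots : ℝ) - 6 * (2 * reg.L k + 1 : ℝ) ^ 4) ^ 2 * ∏ f : Fin Nf, ‖fermionDet (wilsonDirac (fundamentalRep (Fin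 3)) U (reg.mcrit k + reg.a k * m f / reg.Zm k) 1)‖ ∂(wilsonMeasure (d := 4) (L := 2 * reg.L k + 1) (fundamentalRep (Fin 3)) (reg.β k))) ^ 2 := by
  sorry

namespace SkeletonA2
/-! ## Real arithmetic -/

/-- `√(χ₀ s⁴ / K₄) = √(χ₀/K₄) · s²`. [folklore] -/
theorem sqrt_floor_scale (χ₀ K₄ s : ℝ) :
    Real.sqrt (χ₀ * s ^ 4 / K₄) = Real.sqrt (χ₀ / K₄) * s ^ 2 := by
  have h4 : χ₀ * s ^ 4 / K₄ = χ₀ / K₄ * (s ^ 2) ^ 2 := by ring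
  rw [h4, Real.sqrt_mul' _ (sq_nonneg _), Real.sqrt_sq (sq_nonneg s)]

/-- If `K₄/χ₀ ≤ s⁴` (`χ₀, K₄ > 0`) then `1 ≤ √(χ₀/K₄) · s²`. [folklore] -/
theorem one_le_eta_mul_sq {χ₀ K₄ s : ℝ} (hχ₀ : 0 < χ₀) (hK₄ : 0 < K₄)
    (hV : K₄ / χ₀ ≤ s ^ 4) : 1 ≤ Real.sqrt (χ₀ / K₄) * s ^ 2 := by
  have hV' : K₄ ≤ s ^ 4 * χ₀ := (div_le_iff₀ hχ₀).1 hV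
  have h1 : 1 ≤ χ₀ / K₄ * (s ^ 2) ^ 2 := by
    rw [div_mul_eq_mul_div, le_div_iff₀ hK₄, one_mul]
    nlinarith [hV']
  have h2 : Real.sqrt (χ₀ / K₄ * (s ^ 2) ^ 2) = Real.sqrt (χ₀ / K₄) * s ^ 2 := by
    rw [Real.sqrt_mul' _ (sq_nonneg _), Real.sqrt_sq (sq_nonneg s)]
  calc (1 : ℝ) = Real.sqrt 1 := Real.sqrt_one.symm
    _ ≤ Real.sqrt (χ₀ / K₄ * (s ^ 2) ^ 2) := Real.sqrt_le_sqrt h1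
    _ = Real.sqrt (χ₀ / K₄) * s ^ 2 := h2

/-! ## TIGHT⁺ from the two moments -/

/-- **TIGHT⁺ (the extensive pin of the restated hinge) from an intensive susceptibility floor and a
kurtosis cap.** For every witness data `(reg, M₀, m)` and constants `χ₀, K₄ > 0`: if for each probe
`M > M₀`, eventually in `k`, `Z_k > 0`, `χ₀ (a_k(2L_k+1))⁴ Z_k ≤ S₂` and `S₄ Z_k ≤ K₄ S₂²` (moments of
`Q_k(M) = n₋(Γ₅ D_W(U, m_crit(k) − a_k M/Z_m(k), 1)) − 6(2L_k+1)⁴` under the weight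
`∏_f |det D_W(U, m_f(k), 1)|` and the Wilson measure of the scheme torus), then
`∃ η > 0, ∀ M > M₀, ∀ᶠ k, max 1 (η (a_k(2L_k+1))²) ≤ E₊|Q_k(M)|` (literal TIGHT⁺ of
`WindowExtinction`, rev ≥ 9), with `η = √(χ₀/K₄)`.  Hölder `(3/2,3)` via
`intensiveTight_of_indexMoments`; the `max 1` is absorbed because `a_k(2L_k+1) → ∞`. [folklore] -/
theorem tightPlus_of_indexMoments {Nf : ℕ} (reg : QCDRegularisation Nf) (M₀ : ℝ) (m : Fin Nf → ℝ)
    {χ₀ K₄ : ℝ} (hχ₀ : 0 < χ₀) (hK₄ : 0 < K₄)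
    (h : ∀ M : ℝ, M₀ < M → ∀ᶠ k : ℕ in Filter.atTop,
        0 < (∫ U, ∏ f : Fin Nf, ‖fermionDet (wilsonDirac (fundamentalRep (Fin 3)) U (reg.mcrit k + reg.a k * m f / reg.Zm k) 1)‖ ∂(wilsonMeasure (d := 4) (L := 2 * reg.L k + 1) (fundamentalRep (Fin 3)) (reg.β k))) ∧
        χ₀ * (reg.a k * (2 * reg.L k + 1 : ℝ)) ^ 4 * (∫ U, ∏ f : Fin Nf, ‖fermionDet (wilsonDirac (fundamentalRep (Fin 3)) U (reg.mcrit k + reg.a k * m f / reg.Zm k) 1)‖ ∂(wilsonMeasure (d := 4) (L := 2 * reg.L k + 1) (fundamentalRep (Fin 3)) (reg.β k)))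
          ≤ (∫ U, ((Multiset.countP (fun z : ℂ => z.re < 0) (spinorLift gammaFive * wilsonDirac (fundamentalRep (Fin 3)) U (reg.mcrit k - reg.a k * M / reg.Zm k) 1).charpoly.roots : ℝ) - 6 * (2 * reg.L k + 1 : ℝ) ^ 4) ^ 2 * ∏ f : Fin Nf, ‖fermionDet (wilsonDirac (fundamentalRep (Fin 3)) U (reg.mcrit k + reg.a k * m f / reg.Zm k) 1)‖ ∂(wilsonMeasure (d := 4) (L := 2 * reg.L k + 1) (fundamentalRep (Fin 3)) (reg.β k))) ∧
        (∫ U, ((Multiset.countP (fun z : ℂ => z.re < 0) (spinorLift gammaFive * wilsonDirac (fundamentalRep (Fin 3)) U (reg.mcrit k - reg.a k * M / reg.Zm k) 1).charpoly.roots : ℝ) - 6 * (2 * reg.L k + 1 : ℝ) ^ 4) ^ 4 * ∏ f : Fin Nf, ‖fermionDet (wilsonDirac (fundamentalRep (Fin 3)) U (reg.mcrit k + reg.a k * m f / reg.Zm k) 1)‖ ∂(wilsonMeasure (d := 4) (L := 2 * reg.L k + 1) (fundamentalRep (Fin 3)) (reg.β k))) * (∫ U, ∏ f : Fin Nf, ‖fermionDet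 (wilsonDirac (fundamentalRep (Fin 3)) U (reg.mcrit k + reg.a k * m f / reg.Zm k) 1)‖ ∂(wilsonMeasure (d := 4) (L := 2 * reg.L k + 1) (fundamentalRep (Fin 3)) (reg.β k)))
          ≤ K₄ * (∫ U, ((Multiset.countP (fun z : ℂ => z.re < 0) (spinorLift gammaFive * wilsonDirac (fundamentalRep (Fin 3)) U (reg.mcrit k - reg.a k * M / reg.Zm k) 1).charpoly.roots : ℝ) - 6 * (2 * reg.L k + 1 : ℝ) ^ 4) ^ 2 * ∏ f : Fin Nf, ‖fermionDet (wilsonDirac (fundamentalRep (Fin 3)) U (reg.mcrit k + reg.a k * m f / reg.Zm k) 1)‖ ∂(wilsonMeasure (d := 4) (L := 2 * reg.L k + 1) (fundamentalRep (Fin 3)) (reg.β k))) ^ 2) :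
    ∃ η : ℝ, 0 < η ∧ ∀ M : ℝ, M₀ < M → ∀ᶠ k : ℕ in Filter.atTop, max 1 (η * (reg.a k * (2 * reg.L k + 1 : ℝ)) ^ 2) ≤ (∫ U, (|(Multiset.countP (fun z : ℂ => z.re < 0) (spinorLift gammaFive * wilsonDirac (fundamentalRep (Fin 3)) U (reg.mcrit k - reg.a k * M / reg.Zm k) 1).charpoly.roots : ℝ) - 6 * (2 * reg.L k + 1 : ℝ) ^ 4|) * ∏ f : Fin Nf, ‖fermionDet (wilsonDirac (fundamentalRep (Fin 3)) U (reg.mcrit k + reg.a k * m f / reg.Zm k) 1)‖ ∂(wilsonMeasure (d := 4) (L := 2 * reg.L k + 1) (fundamentalRep (Fin 3)) (reg.β k))) / (∫ U, ∏ f : Fin Nf, ‖fermionDet (wilsonDirac (fundamentalRep (Fin 3)) U (reg.mcrit k + reg.a k * m f / reg.Zm k) 1)‖ ∂(wilsonMeasure (d := 4) (L := 2 * reg.L k + 1) (fundamentalRep (Fin 3)) (reg.β k))) := by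
  refine ⟨Real.sqrt (χ₀ / K₄), Real.sqrt_pos.2 (div_pos hχ₀ hK₄), fun M hM => ?_⟩
  filter_upwards [h M hM, physVolume_eventually_ge reg (K₄ / χ₀)] with k hk hvol
  obtain ⟨hZ, hfloor, hcap⟩ := hk
  have hV : 0 < (reg.a k * (2 * reg.L k + 1 : ℝ)) ^ 4 :=
    pow_pos (mul_pos (reg.a_pos k) (by positivity)) 4
  have key := intensiveTight_of_indexMoments Nf (2 * reg.L k + 1) (reg.β k)
    (reg.mcrit k - reg.a k * M / reg.Zm k) (6 * (2 * reg.L k + 1 : ℝ) ^ 4) χ₀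
    ((reg.a k * (2 * reg.L k + 1 : ℝ)) ^ 4) K₄ (fun f => reg.mcrit k + reg.a k * m f / reg.Zm k)
    hχ₀ hV hK₄ hZ hfloor hcap
  rw [sqrt_floor_scale] at key
  exact max_le ((one_le_eta_mul_sq hχ₀ hK₄ hvol).trans key) key

/-! ## The composition of line `tight-from-two-moments` against the restated crux text -/

/-- **A FLOOR–CAP witness inhabits the restated `WindowExtinction`.** If for each `N_f ∈ {2,3}` there
is a mass-scaling, asymptotically scaling regularisation with polynomial volume cap and branch
clause, a threshold `M₀ ≥ 0` and `c > 0` such that every mass tuple `m > M₀` has EXTINCT (verbatim)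
and, for some `χ₀, K₄ > 0`, the second-moment floor and fourth-moment cap of
`tightPlus_of_indexMoments` at every probe `M > M₀`, then `WindowExtinction` holds (TIGHT⁺ by
`tightPlus_of_indexMoments`). [folklore] -/
theorem windowExtinction_of_floorCapWitness
    (h : ∀ Nf : ℕ, (Nf = 2 ∨ Nf = 3) → ∃ reg : QCDRegularisation Nf, reg.HasMassScaling ∧ (reg.scheme 0 0 0).HasAsymptoticScaling ∧ (∃ p : ℕ, ∀ᶠ k : ℕ in Filter.atTop, (reg.L k : ℝ) ≤ (reg.a k)⁻¹ ^ p) ∧ (∀ᶠ k : ℕ in Filter.atTop, -1 < reg.mcrit k) ∧ ∃ M₀ : ℝ, 0 ≤ M₀ ∧ ∃ c : ℝ, 0 < c ∧ ∀ m : Fin Nf → ℝ, (∀ f, M₀ < m f) → (∀ ε : ℝ, 0 < ε → ∀ᶠ k : ℕ in Filter.atTop, ∀ S : ℕ, reg.L k ≤ S → (∫ U, ((∑ f : Fin Nf, ((Multiset.countP (fun z : ℂ => z.im = 0 ∧ z.re < -(reg.mcrit k + reg.a k * m f / reg.Zm k)) (wilsonDirac (fundamentalRep (Fin 3)) U 0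 1).charpoly.roots : ℝ) + (Multiset.countP (fun z : ℂ => |z.re| < c * (reg.a k * m f / reg.Zm k)) (spinorLift gammaFive * wilsonDirac (fundamentalRep (Fin 3)) U (reg.mcrit k + reg.a k * m f / reg.Zm k) 1).charpoly.roots : ℝ)))) * ∏ f : Fin Nf, ‖fermionDet (wilsonDirac (fundamentalRep (Fin 3)) U (reg.mcrit k + reg.a k * m f / reg.Zm k) 1)‖ ∂(wilsonMeasure (d := 4) (L := 2 * S + 1) (fundamentalRep (Fin 3)) (reg.β k))) / (∫ U, ∏ f : Fin Nf, ‖fermionDet (wilsonDirac (fundamentalRep (Fin 3)) U (reg.mcrit k + reg.a k * m f / reg.Zm k) 1)‖ ∂(wilsonMeasure (d := 4) (L := 2 * S + 1) (fundamentalRep (Fin 3)) (reg.β k))) ≤ ε * ((2 * S + 1 : ℝ) / (2 * reg.L k + 1)) ^ 4) ∧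
        ∃ χ₀ : ℝ, 0 < χ₀ ∧ ∃ K₄ : ℝ, 0 < K₄ ∧ ∀ M : ℝ, M₀ < M → ∀ᶠ k : ℕ in Filter.atTop,
        0 < (∫ U, ∏ f : Fin Nf, ‖fermionDet (wilsonDirac (fundamentalRep (Fin 3)) U (reg.mcrit k + reg.a k * m f / reg.Zm k) 1)‖ ∂(wilsonMeasure (d := 4) (L := 2 * reg.L k + 1) (fundamentalRep (Fin 3)) (reg.β k))) ∧
        χ₀ * (reg.a k * (2 * reg.L k + 1 : ℝ)) ^ 4 * (∫ U, ∏ f : Fin Nf, ‖fermionDet (wilsonDirac (fundamentalRep (Fin 3)) U (reg.mcrit k + reg.a k * m f / reg.Zm k) 1)‖ ∂(wilsonMeasure (d := 4) (L := 2 * reg.L k + 1) (fundamentalRep (Fin 3)) (reg.β k)))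
          ≤ (∫ U, ((Multiset.countP (fun z : ℂ => z.re < 0) (spinorLift gammaFive * wilsonDirac (fundamentalRep (Fin 3)) U (reg.mcrit k - reg.a k * M / reg.Zm k) 1).charpoly.roots : ℝ) - 6 * (2 * reg.L k + 1 : ℝ) ^ 4) ^ 2 * ∏ f : Fin Nf, ‖fermionDet (wilsonDirac (fundamentalRep (Fin 3)) U (reg.mcrit k + reg.a k * m f / reg.Zm k) 1)‖ ∂(wilsonMeasure (d := 4) (L := 2 * reg.L k + 1) (fundamentalRep (Fin 3)) (reg.β k))) ∧
        (∫ U, ((Multiset.countP (fun z : ℂ => z.re < 0) (spinorLift gammaFive * wilsonDirac (fundamentalRep (Fin 3)) U (reg.mcrit k - reg.a k * M / reg.Zm k) 1).charpoly.roots : ℝ) - 6 * (2 * reg.L k + 1 : ℝ) ^ 4) ^ 4 * ∏ f : Fin Nf, ‖fermionDet (wilsonDirac (fundamentalRep (Fin 3)) U (reg.mcrit k + reg.a k * m f / reg.Zm k) 1)‖ ∂(wilsonMeasure (d := 4) (L := 2 * reg.L k + 1) (fundamentalRep (Fin 3)) (reg.β k))) * (∫ U, ∏ f : Fin Nf, ‖fermionDet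 (wilsonDirac (fundamentalRep (Fin 3)) U (reg.mcrit k + reg.a k * m f / reg.Zm k) 1)‖ ∂(wilsonMeasure (d := 4) (L := 2 * reg.L k + 1) (fundamentalRep (Fin 3)) (reg.β k)))
          ≤ K₄ * (∫ U, ((Multiset.countP (fun z : ℂ => z.re < 0) (spinorLift gammaFive * wilsonDirac (fundamentalRep (Fin 3)) U (reg.mcrit k - reg.a k * M / reg.Zm k) 1).charpoly.roots : ℝ) - 6 * (2 * reg.L k + 1 : ℝ) ^ 4) ^ 2 * ∏ f : Fin Nf, ‖fermionDet (wilsonDirac (fundamentalRep (Fin 3)) U (reg.mcrit k + reg.a k * m f / reg.Zm k) 1)‖ ∂(wilsonMeasure (d := 4) (L := 2 * reg.L k + 1) (fundamentalRep (Fin 3)) (reg.β k))) ^ 2) :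
    WindowExtinction := by
  intro Nf hNf
  obtain ⟨reg, hms, has, hcap, hbr, M₀, hM₀, c, hc, hm⟩ := h Nf hNf
  refine ⟨reg, hms, has, hcap, hbr, M₀, hM₀, c, hc, fun m hmM => ?_⟩
  obtain ⟨hE, χ₀, hχ₀, K₄, hK₄, hmom⟩ := hm m hmM
  exact ⟨hE, tightPlus_of_indexMoments reg M₀ m hχ₀ hK₄ hmom⟩

/-- **`TipPricing` from a FLOOR–CAP witness produced by the Wegner estimate** — the composition
`TipPricing_of` of line `tight-from-two-moments` re-typed against the current route text
(`TipPricing := TipNoBinding → WegnerEstimate → WindowExtinction`; `TipNoBinding` is not used). [folklore] -/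
theorem tipPricing_of_floorCapWitness
    (h : WegnerEstimate → ∀ Nf : ℕ, (Nf = 2 ∨ Nf = 3) → ∃ reg : QCDRegularisation Nf, reg.HasMassScaling ∧ (reg.scheme 0 0 0).HasAsymptoticScaling ∧ (∃ p : ℕ, ∀ᶠ k : ℕ in Filter.atTop, (reg.L k : ℝ) ≤ (reg.a k)⁻¹ ^ p) ∧ (∀ᶠ k : ℕ in Filter.atTop, -1 < reg.mcrit k) ∧ ∃ M₀ : ℝ, 0 ≤ M₀ ∧ ∃ c : ℝ, 0 < c ∧ ∀ m : Fin Nf → ℝ, (∀ f, M₀ < m f) → (∀ ε : ℝ, 0 < ε → ∀ᶠ k : ℕ in Filter.atTop, ∀ S : ℕ, reg.L k ≤ S → (∫ U, ((∑ f : Fin Nf, ((Multiset.countP (fun z : ℂ => z.im = 0 ∧ z.re < -(reg.mcrit k + reg.a k * m f / reg.Zm k)) (wilsonDirac (fundamentalRep (Fin 3)) U 0 1).charpoly.roots : ℝ) + (Multiset.countP (fun z : ℂ => |z.re| < c * (reg.a k * m f / reg.Zm k)) (spinorLift gammaFive * wilsonDirac (fundamentalRep (Fin 3)) U (reg.mcrit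 k + reg.a k * m f / reg.Zm k) 1).charpoly.roots : ℝ)))) * ∏ f : Fin Nf, ‖fermionDet (wilsonDirac (fundamentalRep (Fin 3)) U (reg.mcrit k + reg.a k * m f / reg.Zm k) 1)‖ ∂(wilsonMeasure (d := 4) (L := 2 * S + 1) (fundamentalRep (Fin 3)) (reg.β k))) / (∫ U, ∏ f : Fin Nf, ‖fermionDet (wilsonDirac (fundamentalRep (Fin 3)) U (reg.mcrit k + reg.a k * m f / reg.Zm k) 1)‖ ∂(wilsonMeasure (d := 4) (L := 2 * S + 1) (fundamentalRep (Fin 3)) (reg.β k))) ≤ ε * ((2 * S + 1 : ℝ) / (2 * reg.L k + 1)) ^ 4) ∧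
        ∃ χ₀ : ℝ, 0 < χ₀ ∧ ∃ K₄ : ℝ, 0 < K₄ ∧ ∀ M : ℝ, M₀ < M → ∀ᶠ k : ℕ in Filter.atTop,
        0 < (∫ U, ∏ f : Fin Nf, ‖fermionDet (wilsonDirac (fundamentalRep (Fin 3)) U (reg.mcrit k + reg.a k * m f / reg.Zm k) 1)‖ ∂(wilsonMeasure (d := 4) (L := 2 * reg.L k + 1) (fundamentalRep (Fin 3)) (reg.β k))) ∧
        χ₀ * (reg.a k * (2 * reg.L k + 1 : ℝ)) ^ 4 * (∫ U, ∏ f : Fin Nf, ‖fermionDet (wilsonDirac (fundamentalRep (Fin 3)) U (reg.mcrit k + reg.a k * m f / reg.Zm k) 1)‖ ∂(wilsonMeasure (d := 4) (L := 2 * reg.L k + 1) (fundamentalRep (Fin 3)) (reg.β k)))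
          ≤ (∫ U, ((Multiset.countP (fun z : ℂ => z.re < 0) (spinorLift gammaFive * wilsonDirac (fundamentalRep (Fin 3)) U (reg.mcrit k - reg.a k * M / reg.Zm k) 1).charpoly.roots : ℝ) - 6 * (2 * reg.L k + 1 : ℝ) ^ 4) ^ 2 * ∏ f : Fin Nf, ‖fermionDet (wilsonDirac (fundamentalRep (Fin 3)) U (reg.mcrit k + reg.a k * m f / reg.Zm k) 1)‖ ∂(wilsonMeasure (d := 4) (L := 2 * reg.L k + 1) (fundamentalRep (Fin 3)) (reg.β k))) ∧
        (∫ U, ((Multiset.countP (fun z : ℂ => z.re < 0) (spinorLift gammaFive * wilsonDirac (fundamentalRep (Fin 3)) U (reg.mcrit k - reg.a k * M / reg.Zm k) 1).charpoly.roots : ℝ) - 6 * (2 * reg.L k + 1 : ℝ) ^ 4) ^ 4 * ∏ f : Fin Nf, ‖fermionDet (wilsonDirac (fundamentalRep (Fin 3)) U (reg.mcrit k + reg.a k * m f / reg.Zm k) 1)‖ ∂(wilsonMeasure (d := 4) (L := 2 * reg.L k + 1) (fundamentalRep (Fin 3)) (reg.β k))) * (∫ U, ∏ f : Fin Nf, ‖fermionDet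 (wilsonDirac (fundamentalRep (Fin 3)) U (reg.mcrit k + reg.a k * m f / reg.Zm k) 1)‖ ∂(wilsonMeasure (d := 4) (L := 2 * reg.L k + 1) (fundamentalRep (Fin 3)) (reg.β k)))
          ≤ K₄ * (∫ U, ((Multiset.countP (fun z : ℂ => z.re < 0) (spinorLift gammaFive * wilsonDirac (fundamentalRep (Fin 3)) U (reg.mcrit k - reg.a k * M / reg.Zm k) 1).charpoly.roots : ℝ) - 6 * (2 * reg.L k + 1 : ℝ) ^ 4) ^ 2 * ∏ f : Fin Nf, ‖fermionDet (wilsonDirac (fundamentalRep (Fin 3)) U (reg.mcrit k + reg.a k * m f / reg.Zm k) 1)‖ ∂(wilsonMeasure (d := 4) (L := 2 * reg.L k + 1) (fundamentalRep (Fin 3)) (reg.β k))) ^ 2) :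
    TipPricing :=
  fun _ hW => windowExtinction_of_floorCapWitness (h hW)


end SkeletonA2

/-! ## Composition -/

/-- **The line's composition**: the FLOOR–CAP witness gives `TipPricing` (floor + cap ⇒ TIGHT⁺ by Hölder; EXTINCT, CAP,
BRANCH and the scalings are carried through; `TipNoBinding` is idle). Concludes the crux by name. -/
theorem TipPricing_of : TipPricing :=
  SkeletonA2.tipPricing_of_floorCapWitness stub_floorCapWitness

end Summit.QuantumFields.QCD.Cruxes.TipPricing.TightFromTwoMoments

end
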